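import Summits.ValiantsHypothesis.ValiantsHypothesis.Theorems.FeketeSOSFeketeSOSHardPaleyRIPMassFloor
import Summits.ValiantsHypothesis.ValiantsHypothesis.Theses.FeketeSOS
import Mathlib.Analysis.SpecialFunctions.Pow.Real

/-!
# Route FeketeSOS — crux `FeketeSOSHard` (stmt-ValiantsHypothesis-3996), line `paley-rip`:
# the logical status of the open stub `stub_tameReduction`, kernel-checked

The line of record `Cruxes/FeketeSOSHard/Lines/paley_rip.lean` closes the crux `X = FeketeSOSHard` from
three stubs: the Paley mass identity A (`stub_paleyMassIdentity`, LANDED), the engine B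
(`stub_paleyFlatRIP`: flat restricted isometry of the Paley–Hankel matrix beyond `√p`, conjecture-class)
and the TAME REDUCTION C (`stub_tameReduction`: a cheap complex representation of `F_p` yields a cyclic
one with `p^{1/2+δ₁}`-sparse squares and archimedean mass `≤ p^{1/2+η}`, `η < κ`).  The line card concedes
"X ⇒ C trivially and A ∧ B ⇒ (C ⇔ X)".  This file puts exactly that status into the tree, sorry-free,
together with the unconditional part of the picture, so that the stub's ledger entry points at theorems
rather than prose:

* `massFloor_of_formBound` — the ENGINE SOCKET: any uniform bound `|Q_p(supp g_j, g_j)| ≤ L·‖g_j‖₂²` on the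
  squares of a cyclic representation gives `p − 1 ≤ L · mass` (A + triangle inequality; no degree hypothesis —
  the mass identity holds for unfolded representations as well, `paleyMassIdentity_of_dvd`).
* `norm_paleyForm_le_card_mul` — trivial-range flatness `|Q_p(S,w)| ≤ #S · Σ_{a∈S}|w_a|²` (`|χ_p| ≤ 1` and
  `2|w_a||w_b| ≤ |w_a|² + |w_b|²`), whence
* `massFloor_sparse` / `massFloor_sparse_rpow` — UNCONDITIONAL "TameHard below the square-root barrier":
  a cyclic representation of `F_p` all of whose squares have `≤ m` monomials has mass `≥ (p − 1)/m`; with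
  `m = p^{1/2−κ}` the mass is `≥ (p − 1)·p^{κ−1/2}`, i.e. already `≫ p^{1/2+η}` for every `η < κ`.  So the
  conclusion of C can only ever be met by squares FATTER than `p^{1/2−η}`: the stub lives entirely in the
  Paley-graph-conjecture window `p^{1/2−κ} < #supp ≤ p^{1/2+δ₁}` of the engine B.
* `massFloor_of_flatRIPAt` / `mass_gt_of_flatRIPAt` — TameHard ⟸ B at one prime: under flat-RIP with
  exponents `(κ, δ₁)` at `p`, every cyclic representation by `p^{1/2+δ₁}`-sparse squares has
  `p − 1 ≤ p^{1/2−κ} · mass`, hence mass `> p^{1/2+η}` as soon as `p^{1/2−κ}·p^{1/2+η} < p − 1`.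
  Consequently, wherever B holds the conclusion of C is UNSATISFIABLE and C collapses to "no cheap
  representation exists", i.e. to X itself:
* `tameReduction_of_feketeSOSHard` — X ⇒ C (rung R3 of the card: vacuity), and
* `feketeSOSHard_of_flatRIPAt_of_tameReductionAt` / `feketeSOSHard_of_flatRIP_of_tameReduction` — the
  line's composition B ⇒ C ⇒ X with A discharged (sorry-free glue: the crux closes by `exact` the moment
  B and C are theorems; per exponent pair: B(κ,δ₁) ∧ C(κ,δ₁) ⇒ X).
* (companion file `…PaleyRIPTameFold.lean`: `exists_cyclic_fold` / `tameReduction_sans_mass` — everything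
  in C EXCEPT the mass clause is free, by the cyclic fold; the content of C is the single inequality
  `Σ_j |c'_j|·‖g'_j‖₂² ≤ p^{1/2+η}`.)

Honest framing.  Nothing here proves C, B or X: C is crux-equivalent modulo B (above), B is PaleyRIP
beyond the square-root bottleneck (Bandeira–Mixon–Moreira 2017, Def. 2.1/Thm 2.3 ⟸ Chung 1994 Conj. 2.2),
X is the route's open thesis; `VP ≠ VNP` is not touched by anything in this file.
-/

set_option linter.dupNamespace false

namespace Summit.ValiantsHypothesis.ValiantsHypothesis.Theorems.FeketeSOSHardPaleyRIP

open Polynomial Finset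
open scoped BigOperators
open Summit.ValiantsHypothesis.ValiantsHypothesis.Theses

noncomputable section

/-! ## The engine socket: any form bound `L` gives mass `≥ (p − 1)/L` -/

section Socket

variable (p : ℕ) [Fact p.Prime]

/-- The Paley mass identity WITHOUT the degree hypothesis of the registered stub (it is carried there, not
used): `X^p − 1 ∣ Σ_i c_i g_i² − F_p` over `ℂ` gives `Σ_i c_i · Q_p(supp g_i, coeff g_i) = p − 1` for
polynomials `g_i` of any degree (the twisted sum `Σ_e χ_p(e)[X^e]` is `p`-periodic). [folklore] -/
theorem paleyMassIdentity_of_dvd (s : ℕ) (c : Fin s → ℂ) (g : Fin s → ℂ[X])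
    (hdvd : (X : ℂ[X]) ^ p - 1 ∣ (∑ i, C (c i) * g i ^ 2) - fek p) :
    (∑ i, c i * paleyForm p (g i).support (fun a => (g i).coeff a)) = (p : ℂ) - 1 := by
  have h0 := twist_eq_zero_of_dvd p hdvd
  rw [map_sub, sub_eq_zero, map_sum, twist_fek] at h0
  rw [← h0]
  refine Finset.sum_congr rfl fun i _ => ?_
  rw [← twist_sq, ← smul_eq_mul, ← map_smul, smul_eq_C_mul]

/-- `‖(p : ℂ) − 1‖ = p − 1` for a prime `p`. [folklore] -/
theorem norm_natCast_prime_sub_one : ‖(p : ℂ) - 1‖ = (p : ℝ) - 1 := by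
  have hprime : p.Prime := Fact.out
  have e : ((p : ℂ) - 1) = (((p : ℝ) - 1 : ℝ) : ℂ) := by push_cast; ring
  have h1 : (1 : ℝ) ≤ (p : ℝ) := by exact_mod_cast hprime.one_lt.le
  rw [e, Complex.norm_real, Real.norm_eq_abs, abs_of_nonneg (by linarith)]

/-- **Engine socket.**  If every square of a cyclic representation `X^p − 1 ∣ Σ_i c_i g_i² − F_p` over `ℂ`
satisfies the form bound `|Q_p(supp g_i, g_i)| ≤ L · Σ_a |g_i(a)|²`, then `p − 1 ≤ L · Σ_i |c_i| Σ_a |g_i(a)|²`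
(mass identity + triangle inequality).  `L = √p` is the landed completion bound (mass floor `(p−1)/√p`),
`L = p^{1/2−κ}` is the engine `stub_paleyFlatRIP` on `p^{1/2+δ₁}`-sparse supports, `L = max #supp` is the
trivial range below. [folklore] -/
theorem massFloor_of_formBound (L : ℝ) (s : ℕ) (c : Fin s → ℂ) (g : Fin s → ℂ[X])
    (hdvd : (X : ℂ[X]) ^ p - 1 ∣ (∑ i, C (c i) * g i ^ 2) - fek p)
    (hQ : ∀ i, ‖paleyForm p (g i).support (fun a => (g i).coeff a)‖ ≤
      L * ∑ a ∈ (g i).support, ‖(g i).coeff a‖ ^ 2) :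
    (p : ℝ) - 1 ≤ L * ∑ i, sqMass (c i) (g i) := by
  classical
  rw [← norm_natCast_prime_sub_one p, ← paleyMassIdentity_of_dvd p s c g hdvd]
  calc ‖∑ i, c i * paleyForm p (g i).support (fun a => (g i).coeff a)‖
      ≤ ∑ i, ‖c i * paleyForm p (g i).support (fun a => (g i).coeff a)‖ := norm_sum_le _ _
    _ = ∑ i, ‖c i‖ * ‖paleyForm p (g i).support (fun a => (g i).coeff a)‖ := by simp_rw [norm_mul]
    _ ≤ ∑ i, ‖c i‖ * (L * ∑ a ∈ (g i).support, ‖(g i).coeff a‖ ^ 2) :=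
        sum_le_sum fun i _ => mul_le_mul_of_nonneg_left (hQ i) (norm_nonneg _)
    _ = L * ∑ i, sqMass (c i) (g i) := by
        rw [mul_sum]; refine sum_congr rfl fun i _ => ?_; unfold sqMass; ring

end Socket

/-! ## Trivial-range flatness and the unconditional sparse mass floor -/

section TrivialRange

variable (p : ℕ) [Fact p.Prime]

/-- `|χ_p(z)| ≤ 1` (the Legendre symbol takes the values `0, ±1`). [folklore] -/
theorem norm_chiC_le_one (z : ℤ) : ‖((legendreSym p z : ℤ) : ℂ)‖ ≤ 1 := by
  rcases quadraticChar_isQuadratic (ZMod p) (z : ZMod p) with h | h | h <;>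
    · unfold legendreSym; rw [h]; simp

/-- **Trivial-range flatness of the Paley–Hankel form**: `|Q_p(S,w)| ≤ #S · Σ_{a∈S} |w_a|²` for every finite
`S ⊆ ℕ` and every `w` (`|χ_p| ≤ 1` and `2|w_a||w_b| ≤ |w_a|² + |w_b|²`).  This is the engine `stub_paleyFlatRIP`
in its trivial range `#S ≤ p^{1/2−κ}`. [folklore] -/
theorem norm_paleyForm_le_card_mul (S : Finset ℕ) (w : ℕ → ℂ) :
    ‖paleyForm p S w‖ ≤ (S.card : ℝ) * ∑ a ∈ S, ‖w a‖ ^ 2 := by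
  unfold paleyForm
  calc ‖∑ a ∈ S, ∑ b ∈ S, ((legendreSym p ((a : ℤ) + b) : ℤ) : ℂ) * w a * w b‖
      ≤ ∑ a ∈ S, ‖∑ b ∈ S, ((legendreSym p ((a : ℤ) + b) : ℤ) : ℂ) * w a * w b‖ := norm_sum_le _ _
    _ ≤ ∑ a ∈ S, ∑ b ∈ S, ‖((legendreSym p ((a : ℤ) + b) : ℤ) : ℂ) * w a * w b‖ :=
        sum_le_sum fun a _ => norm_sum_le _ _
    _ ≤ ∑ a ∈ S, ∑ b ∈ S, (‖w a‖ ^ 2 + ‖w b‖ ^ 2) / 2 := by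
        refine sum_le_sum fun a _ => sum_le_sum fun b _ => ?_
        rw [norm_mul, norm_mul]
        have h1 : ‖((legendreSym p ((a : ℤ) + b) : ℤ) : ℂ)‖ * ‖w a‖ * ‖w b‖ ≤ 1 * ‖w a‖ * ‖w b‖ := by
          gcongr; exact norm_chiC_le_one p _
        have h2 := two_mul_le_add_sq (‖w a‖) (‖w b‖)
        linarith
    _ = (S.card : ℝ) * ∑ a ∈ S, ‖w a‖ ^ 2 := by
        have h : ∀ a ∈ S, ∑ b ∈ S, (‖w a‖ ^ 2 + ‖w b‖ ^ 2) / 2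
            = ((S.card : ℝ) * ‖w a‖ ^ 2 + ∑ b ∈ S, ‖w b‖ ^ 2) / 2 := by
          intro a _
          rw [← Finset.sum_div, Finset.sum_add_distrib, Finset.sum_const, nsmul_eq_mul]
        rw [Finset.sum_congr rfl h, ← Finset.sum_div, Finset.sum_add_distrib, Finset.sum_const,
          nsmul_eq_mul, ← Finset.mul_sum]
        ring

/-- **Unconditional sparse mass floor ("TameHard below the square-root barrier").**  A cyclic representation
`X^p − 1 ∣ Σ_i c_i g_i² − F_p` over `ℂ` all of whose squares have at most `m` monomials has archimedean mass
`Σ_i |c_i| Σ_a |g_i(a)|² ≥ (p − 1)/m`, i.e. `p − 1 ≤ m · Σ_i sqMass c_i g_i` (any number of squares, any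
degrees). [folklore] -/
theorem massFloor_sparse (m : ℝ) (s : ℕ) (c : Fin s → ℂ) (g : Fin s → ℂ[X])
    (hdvd : (X : ℂ[X]) ^ p - 1 ∣ (∑ i, C (c i) * g i ^ 2) - fek p)
    (hsupp : ∀ i, ((g i).support.card : ℝ) ≤ m) :
    (p : ℝ) - 1 ≤ m * ∑ i, sqMass (c i) (g i) := by
  refine massFloor_of_formBound p m s c g hdvd fun i => ?_
  refine (norm_paleyForm_le_card_mul p _ _).trans ?_
  exact mul_le_mul_of_nonneg_right (hsupp i) (sum_nonneg fun a _ => sq_nonneg _)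

/-- The same floor in exponent form: if every square has `#supp g_i ≤ p^{1/2−κ}` then the mass is
`≥ (p − 1) · p^{κ−1/2}` (`≈ p^{1/2+κ}`).  In particular the conclusion of `stub_tameReduction`
(mass `≤ p^{1/2+η}`, `η < κ`) can only be met by squares with MORE than `p^{1/2−κ'}` monomials for every
`κ' > η` (large `p`): the stub lives in the window `p^{1/2−κ} < #supp ≤ p^{1/2+δ₁}` of the engine. [folklore] -/
theorem massFloor_sparse_rpow (κ : ℝ) (s : ℕ) (c : Fin s → ℂ) (g : Fin s → ℂ[X])
    (hdvd : (X : ℂ[X]) ^ p - 1 ∣ (∑ i, C (c i) * g i ^ 2) - fek p)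
    (hsupp : ∀ i, ((g i).support.card : ℝ) ≤ (p : ℝ) ^ (1 / 2 - κ)) :
    ((p : ℝ) - 1) * (p : ℝ) ^ (κ - 1 / 2) ≤ ∑ i, sqMass (c i) (g i) := by
  have hp0 : (0 : ℝ) < (p : ℝ) := by exact_mod_cast (Fact.out : p.Prime).pos
  have h := massFloor_sparse p _ s c g hdvd hsupp
  have hpos : (0 : ℝ) < (p : ℝ) ^ (1 / 2 - κ) := Real.rpow_pos_of_pos hp0 _
  have hinv : (p : ℝ) ^ (κ - 1 / 2) = ((p : ℝ) ^ (1 / 2 - κ))⁻¹ := by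
    rw [← Real.rpow_neg hp0.le]; congr 1; ring
  rw [hinv, ← div_eq_mul_inv, div_le_iff₀ hpos, mul_comm]
  exact h

end TrivialRange

/-! ## TameHard from the engine at one prime -/

section FromFlatRIP

variable (p : ℕ) [Fact p.Prime]

/-- **TameHard ⟸ flat-RIP, at one prime.**  If the Paley–Hankel form is flat with exponents `(κ, δ₁)` at `p`
(`|Q_p(S,w)| ≤ p^{1/2−κ}‖w‖²` for all `S ⊆ [0,p)` with `#S ≤ p^{1/2+δ₁}`), then every cyclic representation
of `F_p` by squares of degree `< p` with `#supp ≤ p^{1/2+δ₁}` has `p − 1 ≤ p^{1/2−κ} · mass`. [folklore] -/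
theorem massFloor_of_flatRIPAt (κ δ₁ : ℝ)
    (hB : ∀ (S : Finset ℕ), (∀ a ∈ S, a < p) → (S.card : ℝ) ≤ (p : ℝ) ^ (1 / 2 + δ₁) →
      ∀ (w : ℕ → ℂ), ‖paleyForm p S w‖ ≤ (p : ℝ) ^ (1 / 2 - κ) * ∑ a ∈ S, ‖w a‖ ^ 2)
    (s : ℕ) (c : Fin s → ℂ) (g : Fin s → ℂ[X])
    (hdeg : ∀ j, (g j).natDegree < p)
    (hsupp : ∀ j, ((g j).support.card : ℝ) ≤ (p : ℝ) ^ (1 / 2 + δ₁))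
    (hdvd : (X : ℂ[X]) ^ p - 1 ∣ (∑ j, C (c j) * g j ^ 2) - fek p) :
    (p : ℝ) - 1 ≤ (p : ℝ) ^ (1 / 2 - κ) * ∑ j, sqMass (c j) (g j) :=
  massFloor_of_formBound p _ s c g hdvd fun j =>
    hB (g j).support (fun a ha => lt_of_le_of_lt (le_natDegree_of_mem_supp a ha) (hdeg j)) (hsupp j)
      (fun a => (g j).coeff a)

/-- Under flat-RIP `(κ, δ₁)` at `p`, once `p^{1/2−κ} · p^{1/2+η} < p − 1` NO cyclic representation of `F_p` by
`p^{1/2+δ₁}`-sparse squares of degree `< p` has mass `≤ p^{1/2+η}`: the conclusion of `stub_tameReduction`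
is then unsatisfiable, so the stub asserts exactly "no cheap representation" — i.e. the crux. [folklore] -/
theorem mass_gt_of_flatRIPAt (κ δ₁ η : ℝ)
    (hB : ∀ (S : Finset ℕ), (∀ a ∈ S, a < p) → (S.card : ℝ) ≤ (p : ℝ) ^ (1 / 2 + δ₁) →
      ∀ (w : ℕ → ℂ), ‖paleyForm p S w‖ ≤ (p : ℝ) ^ (1 / 2 - κ) * ∑ a ∈ S, ‖w a‖ ^ 2)
    (hgap : (p : ℝ) ^ (1 / 2 - κ) * (p : ℝ) ^ (1 / 2 + η) < (p : ℝ) - 1)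
    (s : ℕ) (c : Fin s → ℂ) (g : Fin s → ℂ[X])
    (hdeg : ∀ j, (g j).natDegree < p)
    (hsupp : ∀ j, ((g j).support.card : ℝ) ≤ (p : ℝ) ^ (1 / 2 + δ₁))
    (hdvd : (X : ℂ[X]) ^ p - 1 ∣ (∑ j, C (c j) * g j ^ 2) - fek p) :
    (p : ℝ) ^ (1 / 2 + η) < ∑ j, sqMass (c j) (g j) := by
  have hp0 : (0 : ℝ) < (p : ℝ) := by exact_mod_cast (Fact.out : p.Prime).pos
  have h := massFloor_of_flatRIPAt p κ δ₁ hB s c g hdeg hsupp hdvd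
  by_contra hle
  have hle' : ∑ j, sqMass (c j) (g j) ≤ (p : ℝ) ^ (1 / 2 + η) := not_lt.1 hle
  have : (p : ℝ) - 1 ≤ (p : ℝ) ^ (1 / 2 - κ) * (p : ℝ) ^ (1 / 2 + η) :=
    h.trans (mul_le_mul_of_nonneg_left hle' (Real.rpow_nonneg hp0.le _))
  linarith

end FromFlatRIP

/-! ## Logical status of `stub_tameReduction`: X ⇒ C, and B ∧ C ⇒ X -/

section Status

/-- **X ⇒ C (rung R3 of the line card: vacuity).**  If `FeketeSOSHard` holds with exponent `δ_X`, then
`stub_tameReduction` holds with `δ = δ_X` (and any `η < κ`): its hypotheses describe a cheap representation,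
which X excludes beyond its threshold. [folklore] -/
theorem tameReduction_of_feketeSOSHard (hX : FeketeSOS.FeketeSOSHard) :
    ∀ κ : ℝ, 0 < κ → ∀ δ₁ : ℝ, 0 < δ₁ → ∃ δ : ℝ, 0 < δ ∧ ∃ η : ℝ, η < κ ∧ ∃ p₂ : ℕ,
      ∀ (p : ℕ) [Fact p.Prime], p₂ ≤ p →
      ∀ (s : ℕ) (c : Fin s → ℂ) (g : Fin s → ℂ[X]), (s : ℝ) ≤ (p : ℝ) ^ δ →
        (∀ i, (g i).natDegree ≤ p ^ 2) →
        (∑ i, C (c i) * g i ^ 2) = fek p →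
        (∑ i, ((g i).support.card : ℝ)) < (p : ℝ) ^ (1 / 2 + δ) →
        ∃ (s' : ℕ) (c' : Fin s' → ℂ) (g' : Fin s' → ℂ[X]),
          (∀ j, (g' j).natDegree < p) ∧
          (∀ j, ((g' j).support.card : ℝ) ≤ (p : ℝ) ^ (1 / 2 + δ₁)) ∧
          ((X : ℂ[X]) ^ p - 1 ∣ (∑ j, C (c' j) * g' j ^ 2) - fek p) ∧
          (∑ j, sqMass (c' j) (g' j)) ≤ (p : ℝ) ^ (1 / 2 + η) := by
  intro κ _ δ₁ _
  obtain ⟨δ, hδ, p₀, h⟩ := hX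
  refine ⟨δ, hδ, κ - 1, by linarith, p₀, ?_⟩
  intro p _ hp s c g hs hdeg hrep hsum
  have hX' := h p hp s c g hs hdeg (by rw [hrep]; rfl)
  exact absurd hsum (not_lt.2 hX')

/-- Threshold bookkeeping (copied from the line skeleton): if `2 ≤ p^θ` then `p^{1−θ} ≤ p/2`. [folklore] -/
theorem rpow_one_sub_le_half_of_two_le {p : ℕ} {θ : ℝ} (hp : 0 < p) (h2 : (2 : ℝ) ≤ (p : ℝ) ^ θ) :
    (p : ℝ) ^ (1 - θ) ≤ (p : ℝ) / 2 := by
  have hp0 : (0 : ℝ) < (p : ℝ) := by exact_mod_cast hp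
  rw [Real.rpow_sub hp0, Real.rpow_one]
  have hθ0 : (0 : ℝ) < (p : ℝ) ^ θ := Real.rpow_pos_of_pos hp0 θ
  rw [div_le_div_iff_of_pos_left hp0 hθ0 (by norm_num : (0:ℝ) < 2)]
  exact h2

/-- For `0 < θ` and `p ≥ max(⌈2^{1/θ}⌉, 3)`: `p^{1/2−κ} · p^{1/2+η} < p − 1` where `θ = κ − η`
(the gap hypothesis of `mass_gt_of_flatRIPAt`). [folklore] -/
theorem rpow_gap {p : ℕ} {κ η : ℝ} (hθ : η < κ) (N : ℕ) (hN : (2 : ℝ) ^ (1 / (κ - η)) ≤ (N : ℝ))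
    (hpN : N ≤ p) (hp3 : 3 ≤ p) :
    (p : ℝ) ^ (1 / 2 - κ) * (p : ℝ) ^ (1 / 2 + η) < (p : ℝ) - 1 := by
  have hp3r : (3 : ℝ) ≤ (p : ℝ) := by exact_mod_cast hp3
  have hp0 : (0 : ℝ) < (p : ℝ) := by linarith
  have hθpos : 0 < κ - η := by linarith
  have hexp : (p : ℝ) ^ (1 / 2 - κ) * (p : ℝ) ^ (1 / 2 + η) = (p : ℝ) ^ (1 - (κ - η)) := by
    rw [← Real.rpow_add hp0]; congr 1; ring
  have h2 : (2 : ℝ) ≤ (p : ℝ) ^ (κ - η) := by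
    have hbase : (2 : ℝ) ^ (1 / (κ - η)) ≤ (p : ℝ) := hN.trans (by exact_mod_cast hpN)
    have h20 : (0 : ℝ) ≤ (2 : ℝ) ^ (1 / (κ - η)) := Real.rpow_nonneg (by norm_num) _
    have hmono : ((2 : ℝ) ^ (1 / (κ - η))) ^ (κ - η) ≤ (p : ℝ) ^ (κ - η) :=
      Real.rpow_le_rpow h20 hbase hθpos.le
    have hid2 : ((2 : ℝ) ^ (1 / (κ - η))) ^ (κ - η) = 2 := by
      rw [← Real.rpow_mul (by norm_num : (0:ℝ) ≤ 2)]
      have : (1 / (κ - η)) * (κ - η) = 1 := by field_simp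
      rw [this, Real.rpow_one]
    rw [hid2] at hmono
    exact hmono
  have hhalf : (p : ℝ) ^ (1 - (κ - η)) ≤ (p : ℝ) / 2 :=
    rpow_one_sub_le_half_of_two_le (by exact_mod_cast (show 0 < p by omega)) h2
  rw [hexp]
  linarith

/-- **B(κ,δ₁) ∧ C(κ,δ₁) ⇒ X, per exponent pair** (the line's composition `FeketeSOSHard_of` with the mass
identity A discharged by the landed `stub_paleyMassIdentity`): flat-RIP of the Paley–Hankel form with
exponents `(κ, δ₁)` beyond a threshold, together with the tame reduction AT THE SAME `(κ, δ₁)`, proves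
`FeketeSOSHard`.  A cheap representation would give a tame cyclic one (C), whose mass is `> p^{1/2+η}` by
`mass_gt_of_flatRIPAt` (A + B) — contradiction; `δ` is C's, `p₀ = max(p₁, p₂, ⌈2^{1/(κ−η)}⌉, 3)`.  With
`tameReduction_of_feketeSOSHard`: under B(κ,δ₁), C(κ,δ₁) ⇔ X. [folklore] -/
theorem feketeSOSHard_of_flatRIPAt_of_tameReductionAt (κ δ₁ : ℝ)
    (hB : ∃ p₁ : ℕ, ∀ (p : ℕ) [Fact p.Prime], p₁ ≤ p →
      ∀ (S : Finset ℕ), (∀ a ∈ S, a < p) → (S.card : ℝ) ≤ (p : ℝ) ^ (1 / 2 + δ₁) →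
      ∀ (w : ℕ → ℂ), ‖paleyForm p S w‖ ≤ (p : ℝ) ^ (1 / 2 - κ) * ∑ a ∈ S, ‖w a‖ ^ 2)
    (hC : ∃ δ : ℝ, 0 < δ ∧ ∃ η : ℝ, η < κ ∧ ∃ p₂ : ℕ,
      ∀ (p : ℕ) [Fact p.Prime], p₂ ≤ p →
      ∀ (s : ℕ) (c : Fin s → ℂ) (g : Fin s → ℂ[X]), (s : ℝ) ≤ (p : ℝ) ^ δ →
        (∀ i, (g i).natDegree ≤ p ^ 2) →
        (∑ i, C (c i) * g i ^ 2) = fek p →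
        (∑ i, ((g i).support.card : ℝ)) < (p : ℝ) ^ (1 / 2 + δ) →
        ∃ (s' : ℕ) (c' : Fin s' → ℂ) (g' : Fin s' → ℂ[X]),
          (∀ j, (g' j).natDegree < p) ∧
          (∀ j, ((g' j).support.card : ℝ) ≤ (p : ℝ) ^ (1 / 2 + δ₁)) ∧
          ((X : ℂ[X]) ^ p - 1 ∣ (∑ j, C (c' j) * g' j ^ 2) - fek p) ∧
          (∑ j, sqMass (c' j) (g' j)) ≤ (p : ℝ) ^ (1 / 2 + η)) :
    FeketeSOS.FeketeSOSHard := by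
  classical
  obtain ⟨p₁, hB⟩ := hB
  obtain ⟨δ, hδ, η, hηκ, p₂, hC⟩ := hC
  obtain ⟨N, hN⟩ : ∃ N : ℕ, (2 : ℝ) ^ (1 / (κ - η)) ≤ (N : ℝ) := ⟨_, Nat.le_ceil _⟩
  refine ⟨δ, hδ, max p₁ (max p₂ (max N 3)), ?_⟩
  intro p _ hp s c g hs hdeg hrep
  have hp₁ : p₁ ≤ p := le_trans (le_max_left _ _) hp
  have hp₂ : p₂ ≤ p := le_trans (le_trans (le_max_left _ _) (le_max_right _ _)) hp
  have hpN : N ≤ p :=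
    le_trans (le_trans (le_trans (le_max_left _ _) (le_max_right _ _)) (le_max_right _ _)) hp
  have hp3 : 3 ≤ p :=
    le_trans (le_trans (le_trans (le_max_right _ _) (le_max_right _ _)) (le_max_right _ _)) hp
  have hrep' : (∑ i, C (c i) * g i ^ 2) = fek p := by rw [hrep]; rfl
  by_contra hlt
  have hlt' : (∑ i, ((g i).support.card : ℝ)) < (p : ℝ) ^ (1 / 2 + δ) := not_le.1 hlt
  obtain ⟨s', c', g', hdeg', hsupp', hdvd', hmass⟩ := hC p hp₂ s c g hs hdeg hrep' hlt'
  have hgap := rpow_gap (p := p) hηκ N hN hpN hp3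
  have hgt := mass_gt_of_flatRIPAt p κ δ₁ η (hB p hp₁) hgap s' c' g' hdeg' hsupp' hdvd'
  linarith

/-- **B ⇒ C ⇒ X** with B = `stub_paleyFlatRIP` and C = `stub_tameReduction` VERBATIM (the registered
signatures of the line `paley_rip.lean`): the line's composition, sorry-free — the crux `FeketeSOSHard`
closes by `exact feketeSOSHard_of_flatRIP_of_tameReduction stub_paleyFlatRIP stub_tameReduction` the
moment both stubs are theorems.  Neither is proved here. [folklore] -/
theorem feketeSOSHard_of_flatRIP_of_tameReduction
    (hB : ∃ κ : ℝ, 0 < κ ∧ ∃ δ₁ : ℝ, 0 < δ₁ ∧ ∃ p₁ : ℕ, ∀ (p : ℕ) [Fact p.Prime], p₁ ≤ p →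
      ∀ (S : Finset ℕ), (∀ a ∈ S, a < p) → (S.card : ℝ) ≤ (p : ℝ) ^ (1 / 2 + δ₁) →
      ∀ (w : ℕ → ℂ), ‖paleyForm p S w‖ ≤ (p : ℝ) ^ (1 / 2 - κ) * ∑ a ∈ S, ‖w a‖ ^ 2)
    (hC : ∀ κ : ℝ, 0 < κ → ∀ δ₁ : ℝ, 0 < δ₁ → ∃ δ : ℝ, 0 < δ ∧ ∃ η : ℝ, η < κ ∧ ∃ p₂ : ℕ,
      ∀ (p : ℕ) [Fact p.Prime], p₂ ≤ p →
      ∀ (s : ℕ) (c : Fin s → ℂ) (g : Fin s → ℂ[X]), (s : ℝ) ≤ (p : ℝ) ^ δ →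
        (∀ i, (g i).natDegree ≤ p ^ 2) →
        (∑ i, C (c i) * g i ^ 2) = fek p →
        (∑ i, ((g i).support.card : ℝ)) < (p : ℝ) ^ (1 / 2 + δ) →
        ∃ (s' : ℕ) (c' : Fin s' → ℂ) (g' : Fin s' → ℂ[X]),
          (∀ j, (g' j).natDegree < p) ∧
          (∀ j, ((g' j).support.card : ℝ) ≤ (p : ℝ) ^ (1 / 2 + δ₁)) ∧
          ((X : ℂ[X]) ^ p - 1 ∣ (∑ j, C (c' j) * g' j ^ 2) - fek p) ∧
          (∑ j, sqMass (c' j) (g' j)) ≤ (p : ℝ) ^ (1 / 2 + η)) :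
    FeketeSOS.FeketeSOSHard := by
  obtain ⟨κ, hκ, δ₁, hδ₁, hB'⟩ := hB
  exact feketeSOSHard_of_flatRIPAt_of_tameReductionAt κ δ₁ hB' (hC κ hκ δ₁ hδ₁)

end Status


end

end Summit.ValiantsHypothesis.ValiantsHypothesis.Theorems.FeketeSOSHardPaleyRIP
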